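import Literature.AlgebraicTopology.SingularHomology.StdSimplexPairHomology
import HarnessLib

/-!
# Rigidity of the devices: `relSimplexClass α = (coneClass α)^{±1}`

Topic `Literature/AlgebraicTopology/SingularHomology`. E. H. Spanier, *Algebraic Topology* (1981),
Ch. 7 §4 p. 391: the element `[α] ∈ πₙ(X, A, x₀)` of a map of triples `α : (Δⁿ, Δ̇ⁿ, v₀) → (X, A, x₀)`
is defined through "an arbitrary homeomorphism `h : (Δⁿ, Δ̇ⁿ) → (Iⁿ, İⁿ)` such that `h(v₀) = z₀`";
two choices are compared through the infinite cyclic group `Hₙ(Δⁿ, Δ̇ⁿ)`: "either `h_*{ξₙ} = Zₙ` or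
`h_*{ξₙ} = -Zₙ`". The tree has two such devices — `relSimplexClass` (`RelativeSimplexClass.lean`,
radial homeomorphism and `J`-collapse; the device of the named fact `relHomotopyAddition`) and
`coneClass` (`RelativeHomotopyAdditionCone.lean`, the cone collapse; the device for which the relative
homotopy addition theorem is proved). This file PROVES that **they agree up to a universal sign**:

* `coneChartHCls_eq_or_eq_neg` — the universal class `w = {coneChart ∘ κ_h⁻¹}` equals `±{ξ}` in
  `Hₙ(Δⁿ, ∂Δⁿ; ℤ) ≅ ℤ` (`β_* w = ξ`, `w = (coneChart ∘ κ_h⁻¹)_* ξ`, `ξ ≠ 0`;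
  `eq_or_eq_neg_of_addEquiv_int`);
* `ofMul_coneClass_eq_zsmul` — **rigidity of cone classes under the Hurewicz map** (Spanier's
  argument (d), p. 397, in the form of `coneClass_eq_one_of_bd_sub_mem` for a signed pair): given a
  relative Eilenberg retraction with normalised `1`-skeleta, two maps of triples `γ, γ'` with
  `1`-skeleton at `a` and `{γ} = e • {γ'}` in `Hₙ(X, A; ℤ)` have `[γ]_c = e • [γ']_c`;
* `pointModelClass_eq_coneClass_zpow` — in the universal example `(Δᵏ⁺³, ∂Δᵏ⁺³, v₀)` (simply connected,
  `(k+2)`-connected: `StdSimplexPairConnectivity.lean`, so that `exists_relEilenbergRetraction₁` applies)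
  the point-model class of the identity is `(coneClass id)^{deviceSign k}`, `deviceSign k = ±1`;
* **`relSimplexClass_eq_coneClass_zpow`** — by naturality of both devices (`map_coneClass`), for every
  space `X`, `A ⊆ X`, `a ∈ A` and every map of triples `α : (Δᵏ⁺³, ∂Δᵏ⁺³, v₀) → (X, A, a)`:
  `relSimplexClass α = (coneClass α) ^ deviceSign k`.

Consequently the relative homotopy addition theorem transfers from cone classes to `relSimplexClass`
(`sum_neg_one_pow_smul_relSimplexClass_eq_zero`, for simplices sending the edge `[v₀, v₁]` to `a`); the
discharge of `relHomotopyAddition` (no edge hypothesis, `A` simply connected) is the sequel.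

## References

* E. H. Spanier, *Algebraic Topology*, Springer (1981), Ch. 7 §4 p. 391, §5 Prop. 3 and (d) p. 397.
  [Spanier1981]
* A. Hatcher, *Algebraic Topology*, CUP (2002), §4.1, §4.2 Thm. 4.32. [HatcherAT2002]
-/

noncomputable section

open CategoryTheory Set Function
open scoped unitInterval Topology
open Literature.AlgebraicTopology.Homotopy Literature.AlgebraicTopology.Homotopy.LiddedCube

universe u

namespace Literature.AlgebraicTopology.SingularHomology

/-! ### `w = ± ξ` -/

/-- The universal class is the push-forward of `{ξ}` along `coneChart ∘ κ_h⁻¹`: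
`w = {coneChart ∘ κ_h⁻¹} = (coneChart ∘ κ_h⁻¹)_* {id}`. [cite: Spanier1981, Ch. 7 §4 p. 391] -/
theorem coneChartHCls_eq_map_idSimplexHCls (n : ℕ) :
    coneChartHCls ℤ ℤ n 1 =
      relativeSingularHomology.map ℤ ℤ (coneChartSimplex (ContinuousMap.id (StdSimplex (n + 2))))
        (mapsTo_coneChartSimplex (id_mem_relSimplexMap n)) (n + 2) (idSimplexHCls n ℤ ℤ 1) :=
  simplexHCls_eq_map_idSimplexHCls _ _

/-- **`w = ξ` or `w = -ξ`** in `Hₖ₊₃(Δᵏ⁺³, ∂Δᵏ⁺³; ℤ) ≅ ℤ` (Spanier 1981, p. 391: "either `h_*{ξₙ} = Zₙ`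
or `h_*{ξₙ} = -Zₙ`"): `β_* w = ξ` (`map_pointModelDescent_coneChartHCls`), `w = (coneChart ∘ κ_h⁻¹)_* ξ`,
and `ξ ≠ 0` (`idSimplexHCls_ne_zero`). [cite: Spanier1981, Ch. 7 §4 p. 391] -/
theorem coneChartHCls_eq_or_eq_neg (k : ℕ) :
    coneChartHCls ℤ ℤ (k + 1) 1 = idSimplexHCls (k + 1) ℤ ℤ 1 ∨
      coneChartHCls ℤ ℤ (k + 1) 1 = -idSimplexHCls (k + 1) ℤ ℤ 1 := by
  refine eq_or_eq_neg_of_addEquiv_int (stdSimplexPairHomologyAddEquivInt (k + 1))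
    (relativeSingularHomology.map ℤ ℤ (pointModelDescent (k + 1))
      (fun _ ht => (pointModelDescent_mem (k + 1)).1 _ ht) (k + 1 + 2)).hom.toAddMonoidHom
    (relativeSingularHomology.map ℤ ℤ (coneChartSimplex (ContinuousMap.id (StdSimplex (k + 1 + 2))))
      (mapsTo_coneChartSimplex (id_mem_relSimplexMap (k + 1))) (k + 1 + 2)).hom.toAddMonoidHom
    (idSimplexHCls_ne_zero k) ?_ ?_
  · exact map_pointModelDescent_coneChartHCls (k + 1) ℤ ℤ 1
  · exact (coneChartHCls_eq_map_idSimplexHCls (k + 1)).symm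

/-! ### Rigidity of cone classes under the Hurewicz map -/

section Rigidity

open ConeProof

variable {X : Type u} [TopologicalSpace X] {A : Set X} {a : A} {k : ℕ}

/-- Integer multiples of relative classes: `[e • x] = e • [x]`. [folklore] -/
lemma relCls_zsmul (e : ℤ) (x : (csingularChainComplex ℤ ℤ X).X (k + 3))
    (hx : (csingularChainComplex ℤ ℤ X).d (k + 3) ((ComplexShape.down ℕ).next (k + 3)) x ∈
      chainsInSub ℤ ℤ X A ((ComplexShape.down ℕ).next (k + 3)))
    (hex : (csingularChainComplex ℤ ℤ X).d (k + 3) ((ComplexShape.down ℕ).next (k + 3)) (e • x) ∈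
      chainsInSub ℤ ℤ X A ((ComplexShape.down ℕ).next (k + 3))) :
    (chainsInSub ℤ ℤ X A).relCls (e • x) hex = e • (chainsInSub ℤ ℤ X A).relCls x hx := by
  have hπ : (chainsInSub ℤ ℤ X A).quotient.d (k + 3) ((ComplexShape.down ℕ).next (k + 3))
      (e • (chainsInSub ℤ ℤ X A).π.f (k + 3) x) = 0 := by
    rw [map_smul, (chainsInSub ℤ ℤ X A).d_π_f_eq_zero x hx]
    exact smul_zero _
  rw [Subcomplex.relCls, Subcomplex.relCls]
  exact (homologyCls_congr (map_smul ((chainsInSub ℤ ℤ X A).π.f (k + 3)).hom e x) _ hπ).trans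
    ((homologyCls_smul e _ _ hπ).trans (int_smul_eq_zsmul _ e _))

/-- **Rigidity of cone classes** (Spanier 1981, Ch. 7 §5 (d), p. 397, for a signed pair): given a
relative Eilenberg retraction `ρ` of level `k + 2` with normalised `1`-skeleta, if two maps
`γ, γ' : (Δᵏ⁺³, ∂Δᵏ⁺³) → (X, A)` with `1`-skeleton at `a` have `{γ} = e • {γ'}` in `Hₖ₊₃(X, A; ℤ)`,
then `[γ]_c = e • [γ']_c` in `πₖ₊₃(X, A, a)`: the chain `γ - e γ'` is a relative boundary
`∂w + (chain of A)`, fixed by `ρ♯`, and Spanier's `ψ` (`ConeProof.psi`) kills `∂(ρ♯ w)` (homotopy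
addition theorem) and `ρ♯`(chains of `A`) (compression). [cite: Spanier1981, Ch. 7 §5 p. 397] -/
theorem ofMul_coneClass_eq_zsmul (E : RelEilenbergRetraction₁ X A (a : X) (k + 2))
    {γ γ' : C(StdSimplex (k + 3), X)} (hA : ∀ t ∈ stdBoundary (k + 3), γ t ∈ A)
    (h1 : ∀ t ∈ stdSkel (k + 3) 1, γ t = a) (hA' : ∀ t ∈ stdBoundary (k + 3), γ' t ∈ A)
    (h1' : ∀ t ∈ stdSkel (k + 3) 1, γ' t = a) (e : ℤ)
    (hrel : simplexHCls ℤ ℤ (1 : ℤ) γ (fun _ ht => hA _ ht) = e • simplexHCls ℤ ℤ (1 : ℤ) γ' (fun _ ht => hA' _ ht)) :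
    Additive.ofMul (coneClass (m := k + 1) γ ⟨hA, h1 _ (vertex_mem_stdSkel_one 0)⟩) =
      e • Additive.ofMul (coneClass (m := k + 1) γ' ⟨hA', h1' _ (vertex_mem_stdSkel_one 0)⟩) := by
  set K := csingularChainComplex ℤ ℤ X with hK
  set S : Subcomplex K := chainsInSub ℤ ℤ X A with hS
  have hγE : IsRelEilenberg₁ A (a : X) (k + 2) (SingularSimplex.ofMap γ) := isRelEilenberg₁_ofMap hA h1
  have hγE' : IsRelEilenberg₁ A (a : X) (k + 2) (SingularSimplex.ofMap γ') := isRelEilenberg₁_ofMap hA' h1'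
  -- the elementary chains as relative cycles of the concrete model
  have hdγ := d_simplexChain_mem ℤ ℤ (1 : ℤ) γ (fun _ ht => hA _ ht) ((ComplexShape.down ℕ).next (k + 3))
  have hdγ' := d_simplexChain_mem ℤ ℤ (1 : ℤ) γ' (fun _ ht => hA' _ ht) ((ComplexShape.down ℕ).next (k + 3))
  have hdeγ' : K.d (k + 3) ((ComplexShape.down ℕ).next (k + 3)) (e • simplexChain ℤ ℤ (1 : ℤ) γ') ∈
      S ((ComplexShape.down ℕ).next (k + 3)) := by
    rw [map_smul]
    exact Submodule.smul_mem _ _ hdγ'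
  -- `{γ} = e {γ'}` read in the concrete model
  have hcls : S.relCls (simplexChain ℤ ℤ (1 : ℤ) γ) hdγ =
      S.relCls (e • simplexChain ℤ ℤ (1 : ℤ) γ') hdeγ' := by
    have h := congrArg (relativeSingularHomology.concreteIso ℤ ℤ X A (k + 3)).hom hrel
    rw [map_zsmul, concreteIso_hom_simplexHCls, concreteIso_hom_simplexHCls] at h
    rw [relCls_zsmul e _ hdγ' hdeγ']
    exact h
  rw [Subcomplex.relCls_eq_relCls_iff] at hcls
  have hprev : (ComplexShape.down ℕ).prev (k + 3) = k + 4 := ChainComplex.prev ℕ (k + 3)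
  rw [hprev] at hcls
  obtain ⟨w, hw⟩ := hcls
  -- back to concrete chains: `∂w - x ∈ Δ(A)` with `x = γ - e γ'`
  set x : CChain ℤ X (k + 3) := Finsupp.single (SingularSimplex.ofMap γ) 1 -
    e • Finsupp.single (SingularSimplex.ofMap γ') 1 with hx
  have hw' : csingularChainComplex.bd ℤ (k + 3) w - x ∈ chainsIn ℤ ℤ X A (k + 3) := by
    rw [← csingularChainComplex.d_apply]
    exact hw
  -- apply the retraction: `x = ∂ (ρ♯ w) - ρ♯ z`
  have hfix : E.chainMap ℤ ℤ (k + 3) x = x := by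
    rw [hx, map_sub, map_zsmul, E.chainMap_single_of_isRelEilenberg₁ ℤ ℤ hγE,
      E.chainMap_single_of_isRelEilenberg₁ ℤ ℤ hγE']
  set z : CChain ℤ X (k + 3) := csingularChainComplex.bd ℤ (k + 3) w - x with hz
  have hρz : E.chainMap ℤ ℤ (k + 3) z =
      csingularChainComplex.bd ℤ (k + 3) (E.chainMap ℤ ℤ (k + 4) w) - x := by
    rw [hz, map_sub, E.bd_chainMap ℤ ℤ, hfix]
  have hx_eq : x = csingularChainComplex.bd ℤ (k + 3) (E.chainMap ℤ ℤ (k + 4) w) -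
      E.chainMap ℤ ℤ (k + 3) z := by
    rw [hρz, sub_sub_cancel]
  -- apply `ψ`
  have e1 : psi A a k (csingularChainComplex.bd ℤ (k + 3) (E.chainMap ℤ ℤ (k + 4) w)) = 0 :=
    psi_bd_eq_zero _ fun τ hτ => E.isRelEilenberg₁_of_mem_support_chainMap ℤ ℤ w hτ
  have e2 : psi A a k (E.chainMap ℤ ℤ (k + 3) z) = 0 :=
    psi_eq_zero_of_mem_chainsIn _ (E.chainMap_mem_chainsIn ℤ ℤ hw') fun η hη =>
      mem_relSimplexMap_of_isRelEilenberg₁ (E.isRelEilenberg₁_of_mem_support_chainMap ℤ ℤ z hη)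
  have e3 : psi A a k x =
      Additive.ofMul (coneClass (m := k + 1) γ ⟨hA, h1 _ (vertex_mem_stdSkel_one 0)⟩) -
        e • Additive.ofMul (coneClass (m := k + 1) γ' ⟨hA', h1' _ (vertex_mem_stdSkel_one 0)⟩) := by
    rw [hx, map_sub, map_zsmul, psi_single, psi_single, one_smul, one_smul, psiGen_ofMap, psiGen_ofMap]
  have e4 : psi A a k x = 0 := by rw [hx_eq, map_sub, e1, e2, sub_zero]
  rw [e3, sub_eq_zero] at e4
  exact e4

end Rigidity

/-! ### The universal example -/

section Universal

variable (k : ℕ)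

/-- The identity class `[id]_c ∈ πₖ₊₃(Δᵏ⁺³, ∂Δᵏ⁺³, v₀)` of the cone device. [folklore] -/
abbrev coneIdClass : RelHomotopyGroup.Pi (k + 3) (StdSimplex (k + 3)) (stdBoundary (k + 3)) (bdVertex (k + 1)) :=
  coneClass (ContinuousMap.id (StdSimplex (k + 3))) (id_mem_relSimplexMap (k + 1))

open Classical in
/-- **The universal sign `±1`** relating the two devices: `+1` if the universal class `w` is `{ξ}`,
`-1` if it is `-{ξ}` (Spanier 1981, p. 391). [cite: Spanier1981, Ch. 7 §4 p. 391] -/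
def deviceSign : ℤ := if coneChartHCls ℤ ℤ (k + 1) 1 = idSimplexHCls (k + 1) ℤ ℤ 1 then 1 else -1

/-- `w = deviceSign • ξ`. [cite: Spanier1981, Ch. 7 §4 p. 391] -/
theorem coneChartHCls_eq_deviceSign_smul :
    coneChartHCls ℤ ℤ (k + 1) 1 = deviceSign k • idSimplexHCls (k + 1) ℤ ℤ 1 := by
  unfold deviceSign
  split_ifs with h
  · rw [h, one_smul]
  · rcases coneChartHCls_eq_or_eq_neg k with h' | h'
    · exact absurd h' h
    · rw [h', neg_one_zsmul]

/-- `deviceSign k = 1 ∨ deviceSign k = -1`. [folklore] -/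
theorem deviceSign_eq_or : deviceSign k = 1 ∨ deviceSign k = -1 := by
  unfold deviceSign; split_ifs <;> simp

/-- `deviceSign k * deviceSign k = 1`. [folklore] -/
theorem deviceSign_mul_self : deviceSign k * deviceSign k = 1 := by
  rcases deviceSign_eq_or k with h | h <;> rw [h] <;> norm_num

/-- **`φ[γ]_c = deviceSign • {γ}`** for a map of triples `γ` of the universal example: `φ[γ]_c = γ_* w`
(`relHurewiczMap_coneClass_eq_map`), `w = deviceSign • ξ`, `γ_* ξ = {γ}`. [cite: Spanier1981, Ch. 7 §4 p. 391] -/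
theorem relHurewiczMap_coneClass_universal {γ : C(StdSimplex (k + 3), StdSimplex (k + 3))}
    (hγ : γ ∈ RelSimplexMap (k + 2) (stdBoundary (k + 3)) (bdVertex (k + 1))) :
    relHurewiczMap ℤ ℤ (1 : ℤ) (coneClass (m := k + 1) γ hγ) =
      deviceSign k • simplexHCls ℤ ℤ (1 : ℤ) γ (fun _ ht => hγ.1 _ ht) := by
  rw [relHurewiczMap_coneClass_eq_map, simplexHCls_eq_map_idSimplexHCls γ (fun _ ht => hγ.1 _ ht)]
  change relativeSingularHomology.map ℤ ℤ γ _ (k + 1 + 2) (coneChartHCls ℤ ℤ (k + 1) 1) = _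
  rw [coneChartHCls_eq_deviceSign_smul, map_zsmul]

/-- **The two universal classes agree up to the sign: `ι_r = (ι_c)^{deviceSign}`** in
`πₖ₊₃(Δᵏ⁺³, ∂Δᵏ⁺³, v₀)`. Proof: both classes have normalised representatives `γ_r`, `γ_c`
(`exists_coneClass_eq`); applying the Hurewicz homomorphism, `ξ = φ(ι_r) = s {γ_r}` and
`s ξ = w = φ(ι_c) = s {γ_c}` (`s = deviceSign`), so `{γ_r} = s {γ_c}`, and the rigidity
`ofMul_coneClass_eq_zsmul` (with a relative Eilenberg retraction of the simply connected,
`(k+2)`-connected universal pair, `exists_relEilenbergRetraction₁`) gives `ι_r = s • ι_c`.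
[cite: Spanier1981, Ch. 7 §4 p. 391] -/
theorem pointModelClass_eq_coneIdClass_zpow :
    pointModelClass (k + 1) = coneIdClass k ^ deviceSign k := by
  haveI := simplyConnectedSpace_stdSimplex (k + 3)
  haveI := simplyConnectedSpace_stdBoundary (N := k + 3) (by omega)
  have hconn : ∀ (q : ℕ) [NeZero q], q ≤ k + 2 → ∀ b : ↥(stdBoundary (k + 3)),
      Subsingleton (RelHomotopyGroup.Pi q (StdSimplex (k + 3)) (stdBoundary (k + 3)) b) :=
    fun q _ hq b => subsingleton_relHomotopyGroup_stdSimplex_stdBoundary (by omega) b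
  obtain ⟨E⟩ := exists_relEilenbergRetraction₁ (X := StdSimplex (k + 3)) (stdBoundary (k + 3)) (k + 2) hconn
    (bdVertex (k + 1))
  obtain ⟨γr, hAr, h1r, hr⟩ := exists_coneClass_eq (pointModelClass (k + 1))
  obtain ⟨γc, hAc, h1c, hc⟩ := exists_coneClass_eq (coneIdClass k)
  -- homology classes of the representatives
  have hφr : relHurewiczMap ℤ ℤ (1 : ℤ) (pointModelClass (k + 1)) = idSimplexHCls (k + 1) ℤ ℤ 1 :=
    relHurewiczMap_pointModelClass (k + 1) ℤ ℤ 1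
  have hφc : relHurewiczMap ℤ ℤ (1 : ℤ) (coneIdClass k) = deviceSign k • idSimplexHCls (k + 1) ℤ ℤ 1 := by
    rw [coneIdClass, relHurewiczMap_coneClass_id]; exact coneChartHCls_eq_deviceSign_smul k
  rw [← hr, relHurewiczMap_coneClass_universal] at hφr
  rw [← hc, relHurewiczMap_coneClass_universal] at hφc
  -- `s {γr} = ξ` and `s {γc} = s ξ`, hence `{γr} = s ξ = s {γc}`... via `s * s = 1`
  have hγr : simplexHCls ℤ ℤ (1 : ℤ) γr (fun _ ht => hAr _ ht) = deviceSign k • idSimplexHCls (k + 1) ℤ ℤ 1 := by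
    have := congrArg (fun y => deviceSign k • y) hφr
    simp only [smul_smul, deviceSign_mul_self, one_smul] at this
    exact this
  have hγc : simplexHCls ℤ ℤ (1 : ℤ) γc (fun _ ht => hAc _ ht) = idSimplexHCls (k + 1) ℤ ℤ 1 := by
    have := congrArg (fun y => deviceSign k • y) hφc
    simp only [smul_smul, deviceSign_mul_self, one_smul] at this
    exact this
  have hrel : simplexHCls ℤ ℤ (1 : ℤ) γr (fun _ ht => hAr _ ht) =
      deviceSign k • simplexHCls ℤ ℤ (1 : ℤ) γc (fun _ ht => hAc _ ht) := by
    rw [hγr, hγc]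
  have key := ofMul_coneClass_eq_zsmul E hAr h1r hAc h1c (deviceSign k) hrel
  rw [hr, hc] at key
  have := congrArg Additive.toMul key
  rwa [toMul_ofMul, toMul_zsmul, toMul_ofMul] at this

end Universal

/-! ### Transfer to every pair -/

section Transfer

variable {X : Type u} [TopologicalSpace X] {A : Set X} {a : A} {k : ℕ}

/-- `relSimplexClass α = (coneClass α) ^ deviceSign k` for a map of pairs `α : (Δᵏ⁺³, ∂Δᵏ⁺³) → (X, A)`,
based at `α v₀` (naturality of both devices applied to the universal classes). [cite: Spanier1981, Ch. 7 §4 p. 391] -/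
theorem relSimplexClass_eq_coneClass_zpow_aux (α : C(StdSimplex (k + 3), X))
    (hαA : MapsTo α (stdBoundary (k + 3)) A) :
    relSimplexClass (m := k + 2) (a := ⟨α (bdVertex (k + 1)), hαA (bdVertex (k + 1)).2⟩) α ⟨hαA, rfl⟩ =
      coneClass (m := k + 1) (a := ⟨α (bdVertex (k + 1)), hαA (bdVertex (k + 1)).2⟩) α ⟨hαA, rfl⟩ ^
        deviceSign k := by
  have hr : relSimplexClass (m := k + 2) (a := ⟨α (bdVertex (k + 1)), hαA (bdVertex (k + 1)).2⟩) α ⟨hαA, rfl⟩ =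
      RelHomotopyGroup.map α hαA (pointModelClass (k + 1)) := by
    rw [relSimplexClass_eq_mk, pointModelClass, RelHomotopyGroup.map_mk]
    exact congrArg (Quotient.mk _) (RelGenLoop.ext _ _ fun y => rfl)
  have hc : coneClass (m := k + 1) (a := ⟨α (bdVertex (k + 1)), hαA (bdVertex (k + 1)).2⟩) α ⟨hαA, rfl⟩ =
      RelHomotopyGroup.map α hαA (coneIdClass k) := by
    rw [coneIdClass, map_coneClass]
    exact coneClass_congr _ _ fun t => rfl
  refine hr.trans (Eq.trans ?_ (congrArg (· ^ deviceSign k) hc).symm)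
  rw [pointModelClass_eq_coneIdClass_zpow]
  exact map_zpow (RelHomotopyGroup.mapHom α hαA) (coneIdClass k) (deviceSign k)

/-- **`relSimplexClass α = (coneClass α) ^ deviceSign k`** for every map of triples
`α : (Δᵏ⁺³, ∂Δᵏ⁺³, v₀) → (X, A, a)`: both devices are natural in maps of pairs
(`relSimplexClass α = α_* ι_r`, `coneClass α = α_* ι_c`, `map_relSimplexClass`, `map_coneClass`) and
`ι_r = ι_c^{±1}` in the universal example. (Spanier 1981, p. 391: the classes obtained from two
identifications of `(Δⁿ, Δ̇ⁿ, v₀)` with `(Iⁿ, İⁿ, z₀)` differ by the sign `h_*{ξₙ} = ± Zₙ`.)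
[cite: Spanier1981, Ch. 7 §4 p. 391] -/
theorem relSimplexClass_eq_coneClass_zpow (α : C(StdSimplex (k + 3), X)) (hα : α ∈ RelSimplexMap (k + 2) A a) :
    relSimplexClass α hα = coneClass (m := k + 1) α hα ^ deviceSign k := by
  obtain ⟨a₀, ha₀⟩ := a
  obtain ⟨hαA, hαv⟩ := hα
  change α (stdSimplex.vertex 0) = a₀ at hαv
  subst hαv
  exact relSimplexClass_eq_coneClass_zpow_aux α fun _ ht => hαA _ ht

/-- **The relative homotopy addition theorem for `relSimplexClass`, edge-normalised form**: for every
pair `(X, A)`, `a ∈ A`, and `τ : Δᵏ⁺⁴ → X` sending the codimension-two skeleton into `A`, the vertices to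
`a` and the edge `[v₀, v₁]` to `a`, `∑ᵢ (-1)ⁱ [τ ∘ δᵢ] = 0` in `πₖ₊₃(X, A, a)` for the classes
`relSimplexClass` — the cone-class theorem `sum_neg_one_pow_smul_coneClass_eq_zero`
(`RelativeHomotopyAdditionCone.lean`) transported by `relSimplexClass_eq_coneClass_zpow`
(Spanier 1981, Ch. 7 §5 Prop. 3, pushed-forward form of (d) p. 397). [cite: Spanier1981, Ch. 7 §5 Prop. 3] -/
theorem sum_neg_one_pow_smul_relSimplexClass_eq_zero (τ : C(StdSimplex (k + 4), X))
    (hA : ∀ t ∈ stdSkel (k + 4) (k + 2), τ t ∈ A) (hv : ∀ i : Fin (k + 5), τ (stdSimplex.vertex (S := ℝ) i) = a)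
    (he : EdgeToBase a τ) :
    (∑ i : Fin (k + 5), ((-1 : ℤ) ^ (i : ℕ)) •
        Additive.ofMul (relSimplexClass (m := k + 2) (a := a) (τ.comp (stdFace i))
          (comp_stdFace_mem_relSimplexMap (m := k + 2) τ hA hv i))) = 0 := by
  have h := sum_neg_one_pow_smul_coneClass_eq_zero τ hA hv he
  have key : ∀ i : Fin (k + 5),
      Additive.ofMul (relSimplexClass (m := k + 2) (a := a) (τ.comp (stdFace i))
          (comp_stdFace_mem_relSimplexMap (m := k + 2) τ hA hv i)) =
        deviceSign k • Additive.ofMul (coneClass (τ.comp (stdFace i)) (comp_stdFace_mem_relSimplexMap τ hA hv i)) := by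
    intro i
    rw [relSimplexClass_eq_coneClass_zpow, ofMul_zpow]
  simp_rw [key, smul_comm _ (deviceSign k), ← Finset.smul_sum, h, smul_zero]

end Transfer

end Literature.AlgebraicTopology.SingularHomology

end
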